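import Summits.QuantumAdvantage.QuantumAdvantage.Theorems.PromiseLiftPlLiftStubCertifyK8
import Summits.QuantumAdvantage.QuantumAdvantage.Theorems.PromiseLiftPlLiftStubCanonicalLiftSiegeK3
import Summits.QuantumAdvantage.QuantumAdvantage.Theorems.WhiteBoxWalkWbwThesis
import Summits.QuantumAdvantage.QuantumAdvantage.Theses.PromiseLift
import Literature.Computability.QuantumComplexity.FBQPOracleAccess

/-!
# STUB-PLAN sketch (stub-critic) — `stub_certified_thesis : WbwCertifiedThesis`
(crux `PlLift`, stmt-QuantumAdvantage-0250, line `certified-canonical-lift`, skeleton sha f97c9d33e600)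

Companion of `Cruxes/PlLift/STUB-PLAN-stub_certified_thesis.md` (planner-scrit-stmt-QuantumAdvantage-0250-stub_certified-0,
2026-08-16). The merged helper-lemma list H1–H6 of the top plan (`FactoringAssumption → WbwCertifiedThesis`,
the k2 cut) typed against the PUBLIC thesis names of `Theorems/PromiseLiftPlLiftStubCertifyK8.lean` — ALL PROVED
here (`lean check` rc 0; `#print axioms certifiedThesis_of_factoringAssumption` = propext, Classical.choice,
Quot.sound) — plus the reshape preview of the skeleton's composition (`Reshape.*`; the ONLY `sorry` of the file is
`Reshape.stub_factoring`, the registered conjecture `FactoringAssumption` itself, by design). Everything here is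
for the lead / stub prover to copy (Step 1 of the plan = this file's §H1–H6 as a `Theorems/` file with the last
theorem renamed `stub_certified_of_factoring`); nothing is registered by this file. The k3 typed fallbacks
(`aFac`, `clauseC_of_postFP`, `factorCode_bigProd_fits`) stay in `StubIdeas3_stub_certified_thesis_Sketch.lean`.
-/

set_option linter.dupNamespace false

noncomputable section

namespace Summit.QuantumAdvantage.QuantumAdvantage.Cruxes.PlLift.CertifiedCanonicalLift.StubPlan

open Filter Asymptotics _root_.Computability Polynomial
open Literature.Computability.Complexity Literature.Computability.Cryptography
open Literature.Computability.Complexity.Brick (fstF sndF fstF_boolPair sndF_boolPair fstF_mem_FP sndF_mem_FP)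
open Literature.Computability.Complexity.Plumb (takeFn takeFn_boolPair takeFn_mem_FP polyFn polyFn_apply polyFn_mem_FP)
open Literature.Computability.Complexity.Knapsack (decNatList canonLFn canonLFn_eq canonLFn_mem_FP)
open Literature.Computability.Complexity.OracleCompose (concatFn concatFn_boolPair concatFn_mem_FP)
open Literature.Computability.QuantumComplexity (isQSolvable_classicalWrap_dep)
open Summit.QuantumAdvantage.QuantumAdvantage.Theorems (FactoringAssumption)
open Summit.QuantumAdvantage.QuantumAdvantage.Theorems.WhiteBoxWalk

/-! ## Width pinning: `takePad` and its FP brick -/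

/-- Zero-pad then cut to width `ℓ` (forces `|·| = ℓ` on every input). [folklore] -/
def takePad (ℓ : ℕ) (w : List Bool) : List Bool := (w ++ List.replicate ℓ false).take ℓ

@[simp] theorem length_takePad (ℓ : ℕ) (w : List Bool) : (takePad ℓ w).length = ℓ := by
  simp [takePad]

theorem takePad_of_length_eq {ℓ : ℕ} {w : List Bool} (h : w.length = ℓ) : takePad ℓ w = w := by
  simp [takePad, ← h]

/-- The FP brick `⟨x, w⟩ ↦ takePad (p |x|) w` (bricks: `Plumb.takeFn`, `Plumb.polyFn`, `concatFn`, `Kannan.zerosFn`). [folklore] -/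
def takePadFn (p : Polynomial ℕ) : List Bool → List Bool :=
  takeFn ∘ fanoutFn (polyFn p ∘ fstF) (concatFn ∘ fanoutFn sndF (Kannan.zerosFn ∘ polyFn p ∘ fstF))

@[simp] theorem takePadFn_boolPair (p : Polynomial ℕ) (x w : List Bool) :
    takePadFn p (boolPair x w) = takePad (p.eval x.length) w := by
  simp [takePadFn, takePad, Kannan.zerosFn_apply]

theorem takePadFn_mem_FP (p : Polynomial ℕ) : takePadFn p ∈ FP :=
  comp_mem_FP takeFn_mem_FP (fanoutFn_mem_FP (comp_mem_FP (polyFn_mem_FP p) fstF_mem_FP)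
    (comp_mem_FP concatFn_mem_FP (fanoutFn_mem_FP sndF_mem_FP
      (comp_mem_FP Kannan.zerosFn_mem_FP (comp_mem_FP (polyFn_mem_FP p) fstF_mem_FP)))))

/-! ## H1 (XS, proved ×3 by the ideators): the certificate slot is free at the typed level -/

/-- H1 `X_pd → X_cert` with the trivial verifier `V ≡ true` (`const_mem_FP [true]`). With the LANDED
`stub_certify` this makes the stub EQUIVALENT to `WbwCanonicalThesis`. [folklore] -/
theorem certified_of_canonical : WbwCanonicalThesis → WbwCertifiedThesis := by
  rintro ⟨gen, ans, a, p, hgen, hag, hlen, ⟨F, hF, hU, hQ⟩, hC⟩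
  exact ⟨gen, ans, a, fun _ => true, p, hgen, const_mem_FP [true], fun _ => rfl, hag, hlen,
    ⟨F, hF, hU, fun x _ => hQ x⟩, hC⟩

theorem certified_iff_canonical : WbwCertifiedThesis ↔ WbwCanonicalThesis :=
  ⟨stub_certify, certified_of_canonical⟩

/-! ## H2 (S): clause (C) from one-wayness + canonical preimage — the (C)-half of the landed `stub_bridge` -/

/-- H2 (= k1 A0 = k2 A3 ⊇ k3 L1). The truncation adversary of `Theorems/WhiteBoxWalkWbwThesisBridge.lean`
(`Bridge.isPPT_of_run_eq_take`, `Bridge.run_eq_of_prefix`), stated on its own: a PPT printing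
`pre s ++ 0…0` on `⟨1ⁿ, gen s⟩` is a PPT inverter of `gen`. Copy of the second bullet of `stub_bridge`.
[cite: Goldreich2001, Def. 2.2.1] -/
theorem clauseC_of_isOneWay {gen pre : List Bool → List Bool} (hgen : IsOneWay gen)
    (hpre : ∀ s, gen (pre s) = gen s) (hlen : ∀ s, (pre s).length = s.length) :
    ∀ A : RandAlg (List Bool) (List Bool), IsPPT A id →
      SuperpolynomialDecay atTop (fun n : ℕ => (n : ℝ)) fun n : ℕ =>
        uniformAvg n fun s => A.pr id (boolPair (unaryEncodeNat n) (gen s))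
          {y | pre s ++ List.replicate ((gen s).length - s.length) false <+: y} := by
  intro A hA
  obtain ⟨B, hrun, hcoin⟩ : ∃ B : RandAlg (List Bool) (List Bool),
      (∀ z r, B.run z r = (A.run z r).take (fstF z).length) ∧ B.coinLen = A.coinLen :=
    ⟨⟨fun z r => (A.run z r).take (fstF z).length, A.coinLen⟩, fun _ _ => rfl, rfl⟩
  refine (hgen.2 B (Bridge.isPPT_of_run_eq_take hA hrun hcoin)).trans_abs_le fun n => ?_
  rw [abs_of_nonneg (invertProb_nonneg _ _ _),
    abs_of_nonneg (uniformAvg_nonneg fun _ => RandAlg.pr_nonneg _ _ _ _)]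
  unfold invertProb uniformAvg
  refine div_le_div_of_nonneg_right (Finset.sum_le_sum fun x _ => ?_) (by positivity)
  classical
  dsimp only
  rw [RandAlg.pr_eq_uniformProb, RandAlg.pr_eq_uniformProb, hcoin]
  unfold uniformProb
  refine div_le_div_of_nonneg_right ?_ (by positivity)
  exact_mod_cast Finset.card_le_card fun r hr => by
    simp only [Finset.mem_filter, Finset.mem_univ, true_and, Set.mem_setOf_eq] at hr ⊢
    have hu : (unaryEncodeNat n).length = (pre x.toList).length := by
      rw [hlen, x.toList_length]
      exact unary_decode_encode_nat n
    rw [Bridge.run_eq_of_prefix hrun hu hr, hpre]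

/-! ## H3 (S): the factor-list code has an FP canonicaliser (copy of `factorGraph_mem_BQP`'s 6 lines) -/

/-- H3 (= k2 A2′). `pick := canonLFn ∘ sndF` re-encodes the self-delimited list-code prefix of `y`,
whatever the junk after it (`canonLFn_eq`, `Knapsack.decode_natList`, `listBool_decode_encode_append`).
[cite: AroraBarakCC2009, §0.1 (self-delimiting tuples)] -/
theorem factorCode_pick : ∃ pick : List Bool → List Bool, pick ∈ FP ∧
    ∀ u y : List Bool, factorCode (decodeNat u) <+: y → pick (boolPair u y) = factorCode (decodeNat u) := by
  refine ⟨canonLFn ∘ sndF, comp_mem_FP canonLFn_mem_FP sndF_mem_FP, fun u y hy => ?_⟩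
  obtain ⟨t, rfl⟩ := hy
  rw [Function.comp_apply, sndF_boolPair, canonLFn_eq]
  unfold factorCode
  congr 1
  have h1 := Literature.Computability.Complexity.Knapsack.decode_natList
    (encodingListNatBool.encode (decodeNat u).primeFactorsList ++ t)
  rw [Literature.Computability.Cryptography.listBool_decode_encode_append] at h1
  exact (Option.some.inj h1).symm

/-! ## H4 (M): GENERIC everywhere-canonicity of a planted FBQP function -/

/-- H4 (= k2 A2, the one genuinely new plumbing lemma). An `FBQP` function `f` with an FP canonicaliser
`pick` of its output prefix, planted through FP pre/post-processing and cut to exact width `p |x|`, is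
written FIRST with probability `≥ 2/3` on EVERY input by one uniform oracle-free Clifford+T family:
`isQSolvable_classicalWrap_dep pre G` with `G ⟨x, y⟩ := takePad (p|x|) (post ⟨x, pick ⟨pre x, y⟩⟩)`, then
monotonicity (`hread` makes `G` canonical on the `≥ 2/3` event). [cite: BernsteinVazirani1997, §8] -/
theorem everywhereQ_of_mem_FBQP {f pre post pick : List Bool → List Bool} (p : Polynomial ℕ)
    (hf : f ∈ FBQP) (hpre : pre ∈ FP) (hpost : post ∈ FP) (hpick : pick ∈ FP)
    (hread : ∀ u y, f u <+: y → pick (boolPair u y) = f u) :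
    IsQSolvable fun x => {y | takePad (p.eval x.length) (post (boolPair x (f (pre x)))) <+: y} := by
  obtain ⟨F, hFfree, hU, hF⟩ := hf
  have hG : (takePadFn p ∘ fanoutFn fstF (post ∘ fanoutFn fstF (pick ∘ fanoutFn (pre ∘ fstF) sndF))) ∈ FP :=
    comp_mem_FP (takePadFn_mem_FP p) (fanoutFn_mem_FP fstF_mem_FP (comp_mem_FP hpost
      (fanoutFn_mem_FP fstF_mem_FP (comp_mem_FP hpick
        (fanoutFn_mem_FP (comp_mem_FP hpre fstF_mem_FP) sndF_mem_FP)))))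
  have hGval : ∀ x y,
      (takePadFn p ∘ fanoutFn fstF (post ∘ fanoutFn fstF (pick ∘ fanoutFn (pre ∘ fstF) sndF))) (boolPair x y)
        = takePad (p.eval x.length) (post (boolPair x (pick (boolPair (pre x) y)))) := by
    intro x y
    simp
  refine (isQSolvable_classicalWrap_dep pre _ hpre hG hFfree hU (fun x => {y | f (pre x) <+: y})
    (fun x => hF (pre x))).mono fun x => ?_
  rintro z ⟨y, hy, hz⟩
  have hy' : f (pre x) <+: y := hy
  show takePad (p.eval x.length) (post (boolPair x (f (pre x)))) <+: z
  rwa [hGval, hread _ _ hy'] at hz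

/-! ## H5 (S–M given H3/H4): the everywhere-canonical answer map of the factoring witness -/

/-- H5 (= k2 A4 = k1 A1 without the normaliser = the content of k3 L3+L4 without the transport).
`aPQ x := takePad |x| (g ⟨x, factorCode ⟦h x⟧⟩)` with `h, g` the FP programs of `stub_extract` /
`stub_assemble` and Shor's family (`factoring_mem_FBQP_holds`) run on `h x`: total, `|aPQ x| = |x|`,
`aPQ (genPQ w) = ansPQ w` (`gspec` + `|ansPQ w| = |genPQ w|`), written first w.p. `≥ 2/3` on EVERY `x`.
[cite: Shor1997, §5] [cite: BernsteinVazirani1997, §8] -/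
theorem canonical_factoring_witness :
    ∃ a : List Bool → List Bool, (∀ w, a (genPQ w) = ansPQ w) ∧
      (∀ x, (a x).length = (X : Polynomial ℕ).eval x.length) ∧
      ∃ F : QCircuitFamily cliffordT, F.IsOracleFree ∧ F.IsUniform ∧
        ∀ x, 2 / 3 ≤ F.kernelProb 0 x {y | a x <+: y} := by
  obtain ⟨h, hh, hspec⟩ := stub_extract
  obtain ⟨g, hg, gspec⟩ := stub_assemble
  obtain ⟨pick, hpick, hread⟩ := factorCode_pick
  have hf : (fun u => factorCode (decodeNat u)) ∈ FBQP := factoring_mem_FBQP_holds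
  obtain ⟨F, hFfree, hU, hF⟩ :=
    everywhereQ_of_mem_FBQP (f := fun u => factorCode (decodeNat u)) X hf hh hg hpick hread
  refine ⟨fun x => takePad ((X : Polynomial ℕ).eval x.length) (g (boolPair x (factorCode (decodeNat (h x))))),
    fun w => ?_, fun x => length_takePad _ _, F, hFfree, hU, hF⟩
  show takePad ((X : Polynomial ℕ).eval (genPQ w).length)
      (g (boolPair (genPQ w) (factorCode (decodeNat (h (genPQ w)))))) = ansPQ w
  rw [hspec w, decode_encodeNat, gspec w _ List.prefix_rfl, eval_X]
  exact takePad_of_length_eq (length_ansPQ (stub_canon w).2.1 (stub_canon w).2.2)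

/-! ## H6 (XS, assembly): the factoring assumption implies X_pd and X_cert -/

/-- H6a `FactoringAssumption → WbwCanonicalThesis` (`gen := genPQ`, `ans := ansPQ`, `p := X`, H5, H2 with
`pre := prePQ` via `stub_canon`). CONDITIONAL on the registered conjecture `Theorems/FactoringAssumption.lean`;
everything else is proved. [cite: Goldreich2001, §2.2.4.1, Thm. 2.3.2] [cite: Shor1997, §5] -/
theorem canonicalThesis_of_factoringAssumption (hF : FactoringAssumption) : WbwCanonicalThesis := by
  obtain ⟨a, hag, hlen, hQ⟩ := canonical_factoring_witness
  refine ⟨genPQ, ansPQ, a, X, (isOneWay_genPQ hF).1, hag, hlen, hQ, ?_⟩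
  intro A hA
  simpa [ansPQ] using clauseC_of_isOneWay (isOneWay_genPQ hF) (fun w => (stub_canon w).1)
    (fun w => (stub_canon w).2.1) A hA

/-- H6b **the stub, conditionally**: `FactoringAssumption → WbwCertifiedThesis`. [cite: Goldreich2001, §2.2.4.1] -/
theorem certifiedThesis_of_factoringAssumption (hF : FactoringAssumption) : WbwCertifiedThesis :=
  certified_of_canonical (canonicalThesis_of_factoringAssumption hF)

/-- Minimal-counterexample reading (k3): refuting the stub refutes the factoring assumption. [folklore] -/
theorem not_factoringAssumption_of_not_certified (h : ¬ WbwCertifiedThesis) : ¬ FactoringAssumption :=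
  fun hF => h (certifiedThesis_of_factoringAssumption hF)

/-! ## Reshape preview (for the LEAD; mirrors Cruxes/WbwThesis/Lines/Sketch.lean): the S-half re-cut as
`stub_factoring` (hypothesis-grade conjecture leaf) + `stub_certified_of_factoring` (provable = H6b),
`stub_certified_thesis` derived, composition still concluding `PlLift` BY NAME -/

namespace Reshape

/-- STUB (THE CONJECTURE, hypothesis-grade; the same registered leaf as crux `WbwThesis`'s line). -/
theorem stub_factoring : FactoringAssumption := by
  sorry

/-- STUB (provable NOW; = `certifiedThesis_of_factoringAssumption`; the siege-k3 calibration file proves it too). -/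
theorem stub_certified_of_factoring : FactoringAssumption → WbwCertifiedThesis :=
  certifiedThesis_of_factoringAssumption

/-- The old S-half, now DERIVED (no `sorry` of its own). -/
theorem certified_thesis : WbwCertifiedThesis := stub_certified_of_factoring stub_factoring

/-- The reshaped composition concluding the crux decl `PromiseLift.PlLift` by name. [folklore] -/
theorem PlLift_of (h₀ : FactoringAssumption) (h₁ : FactoringAssumption → WbwCertifiedThesis)
    (h₂ : WbwCertifiedThesis → WbwCanonicalThesis) (h₃ : WbwCanonicalThesis → QuantumAdvantage) :
    Summit.QuantumAdvantage.QuantumAdvantage.Theses.PromiseLift.PlLift := by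
  intro hcollapse
  obtain ⟨L, hL, hLn⟩ := h₃ (h₂ (h₁ h₀))
  exact absurd (hcollapse hL) hLn

/-- Wiring check with the two LANDED stubs (K8 `stub_certify`, SiegeK3 `stub_canonical_lift`; the two copies
of `WbwCanonicalThesis` are syntactically identical, hence defeq). -/
example : Summit.QuantumAdvantage.QuantumAdvantage.Theses.PromiseLift.PlLift :=
  PlLift_of stub_factoring stub_certified_of_factoring stub_certify
    Summit.QuantumAdvantage.QuantumAdvantage.Theorems.PlLift.CertifiedCanonicalLift.SiegeK3.stub_canonical_lift

/-- End to end under the factoring assumption: the summit (benchmark grade; Shor-redundant by design). -/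
example (hF : FactoringAssumption) : QuantumAdvantage :=
  Summit.QuantumAdvantage.QuantumAdvantage.Theorems.PlLift.CertifiedCanonicalLift.SiegeK3.stub_canonical_lift
    (stub_certify (certifiedThesis_of_factoringAssumption hF))

end Reshape


end Summit.QuantumAdvantage.QuantumAdvantage.Cruxes.PlLift.CertifiedCanonicalLift.StubPlan

end
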